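import Summits.Ventures.YMGap.RobustBall.PerturbedOneLink
import Summits.Ventures.YMGap.RobustBall.RobustOneLink
import HarnessLib

/-!
# Venture YMGap, track ROBUST-BALL — the robust single-link Dobrushin door

HONEST FRAMING. WHAT THIS IS: a venture file (cell `pub-ymgap`, track Y2 ROBUST-BALL, seat rb-p1): the
SINGLE-LINK DOBRUSHIN DOOR, UNIFORM ON A BALL OF ACTIONS. For the perturbed `SU(N)` lattice action
`N β S_W + W` on `ℤ^d` (`perturbedYM (fundamentalRep (Fin N)) (N β) W supp`, 't Hooft coupling `β`)
with `W` a Georgii link potential whose LOADS are bounded — oscillation load `a` (sum over the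
interaction sets through a link of the oscillations of their terms IN THAT LINK), cross-Lipschitz load `Λ`
(sum over the range of a link of the one-link Lipschitz constants of the terms through it), both
HYPOTHESES ON NUMBERS, not on the particular `W` (referee test T2.4) — and a one-link Poincaré /
variance pair `(c, v)` for the UNPERTURBED Wilson one-link family on the operator-norm ball of radius
`b ≥ 2(d-1)|β|`, it proves: Dobrushin's condition in the Vasserstein form with row sums
`ρ = 6(d-1)|β| e^{a} √(c v) + e^{a/2} √c Λ`; hence for `ρ < 1` (i) at most ONE DLR state and (ii) for
every DLR state exponential clustering of Lipschitz cylinder observables in the Shen–Zhu–Zhu form with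
rate `-log max(ρ, 1/2)` per `R₀ = max(1, R)` lattice units, `R` the range of `W`. At `W = 0`
(`a = Λ = 0`) this is the tree's Poincaré-route single-link window `6(d-1)|β|√(c v) < 1`.
WHAT THIS IS NOT: no existence of the DLR state (`PerturbedExistence.lean`), hence not yet the packaged
`HasUniqueGibbsMeasure`; no number (`β⋆, ε` rows are a separate file); the star / slab doors are not
touched; strong-coupling LATTICE statement, no continuum limit, no Millennium claim.

## The loads (hypotheses, all on numbers)

* per-link OSCILLATION witnesses `|W_X(U) - W_X(U')| ≤ osc X e` for `U = U'` off `e` (the tree's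
  `Dobrushin.IsOscBound (W X) (osc X)`), with `∑_{X ∈ supp{e}, e ∈ X} osc X e ≤ a` for every link `e`;
* per-link LIPSCHITZ witnesses `|W_X(U) - W_X(U')| ≤ lip X y · ‖U_y - U'_y‖_F` for `U = U'` off `y`
  (the tree's `DobrushinMetric.IsLipBound suFrobDist (W X) (lip X)`), with cross load
  `∑_{y ∈ perturbedNbr supp e} ∑_{X ∈ supp{e}, e ∈ X} lip X y ≤ Λ` for every `e` (no self-Lipschitz
  load is needed on this route);
* range: `‖e.1 - y.1‖_∞ ≤ R` for `y ∈ X ∈ supp{e}`, `e ∈ X` (only for the conversion of the decay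
  rate to lattice units).
Any typed norm on `W` dominating `(a/2, Λ)` with a range cutoff (e.g. the referee's
`sup_e ∑_{X∋e} |X| (‖W_X‖_∞ + max_y Lip_y W_X)`) instantiates these; that instantiation is the ball file.

## References

* R. L. Dobrushin, Theory Probab. Appl. 15 (1970) 458; H. Föllmer, LNM 1362 (1988) Ch. I (2.7)–(2.24).
* H. Shen, R. Zhu, X. Zhu, CMP 400 (2023) 805, Thm. 1.2, Cor. 1.6 (the clustering currency).
* The tree: `LatticeGaugeDobrushin.lean` (`shen_zhu_zhu_of_dobrushinCondition`, the `W = 0` template),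
  `DobrushinMetricStates.lean` (`subsingleton_gibbsMeasures_of_isKRContraction`,
  `abs_covariance_le_of_isKRContraction`).
-/

noncomputable section

open MeasureTheory Filter Function ProbabilityTheory Real
open scoped NNReal
open Literature.Probability.LatticeModels
open Literature.Probability.LatticeModels.DobrushinMetric
open Literature.MathematicalPhysics.QuantumLattice
open Literature.MathematicalPhysics.QuantumFieldTheory hiding ZdEdge

namespace Summit.Ventures.YMGap.RobustBall

variable {d N : ℕ}

/-! ### Bookkeeping: sets through a link, the influence count over any link set, distances -/

section Bookkeeping

/-- `(X ∩ {e}).Nonempty ↔ e ∈ X` — the filter of `hamiltonianIn` at the volume `{e}` is "the sets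
through `e`". -/
theorem inter_singleton_nonempty_iff {e : ZdEdge d} {X : Finset (ZdEdge d)} :
    (X ∩ {e}).Nonempty ↔ e ∈ X := by
  constructor
  · rintro ⟨z, hz⟩
    rw [Finset.mem_inter, Finset.mem_singleton] at hz
    exact hz.2 ▸ hz.1
  · exact fun h => ⟨e, Finset.mem_inter.2 ⟨h, Finset.mem_singleton_self e⟩⟩

/-- The two spellings of "the listed sets through `e`" agree. -/
theorem filter_inter_singleton_eq (supp : Finset (ZdEdge d) → Finset (Finset (ZdEdge d)))
    (e : ZdEdge d) :
    (supp {e}).filter (fun X => (X ∩ {e}).Nonempty) = (supp {e}).filter fun X => e ∈ X :=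
  Finset.filter_congr fun _ _ => inter_singleton_nonempty_iff

/-- **Row sums of the influence count over ANY link set**: `∑_{y ∈ T} n(e, y) ≤ 6(d-1)` — each of the
`≤ 2(d-1)` plaquettes through `e` has three staple positions, each occupied by one link
(the tree's `sum_linkInfluence_le` is the case `T = linkPlaqNbr e`). -/
theorem sum_linkInfluence_le_of_subset [DecidableEq (ZdEdge d)] (e : ZdEdge d) (T : Finset (ZdEdge d)) :
    ∑ y ∈ T, linkInfluence e y ≤ 6 * (d - 1) := by
  unfold linkInfluence
  rw [Finset.sum_comm]
  calc ∑ p ∈ plaquettesTouching {e}, ∑ y ∈ T, ∑ k : Fin 3, (if stapleLinks p e k = y then 1 else 0)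
      ≤ ∑ _p ∈ plaquettesTouching {e}, 3 := by
        refine Finset.sum_le_sum fun p _ => ?_
        rw [Finset.sum_comm]
        calc ∑ k : Fin 3, ∑ y ∈ T, (if stapleLinks p e k = y then 1 else 0)
            ≤ ∑ _k : Fin 3, 1 := Finset.sum_le_sum fun k _ => by
              rw [Finset.sum_ite_eq]
              split_ifs <;> simp
          _ = 3 := by simp
    _ = 3 * (plaquettesTouching {e}).card := by rw [Finset.sum_const, smul_eq_mul, mul_comm]
    _ ≤ 3 * (2 * (d - 1)) := Nat.mul_le_mul_left 3 (card_plaquettesTouching_singleton_le e)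
    _ = 6 * (d - 1) := by ring

/-- Triangle inequality for the distance to a link set: `dist(x, Λ) ≤ dist(y, Λ) + ‖x - y‖_∞`. -/
theorem linkSetDist_le_add_norm (Λ : Finset (ZdEdge d)) (x y : ZdEdge d) :
    linkSetDist Λ x ≤ linkSetDist Λ y + ‖x.1 - y.1‖ := by
  unfold linkSetDist
  split_ifs with h
  · have key : ∀ y' ∈ Λ, Λ.inf' h (fun y' => ‖x.1 - y'.1‖) - ‖x.1 - y.1‖ ≤ ‖y.1 - y'.1‖ :=
      fun y' hy' => by
        have h1 : Λ.inf' h (fun y' => ‖x.1 - y'.1‖) ≤ ‖x.1 - y'.1‖ := Finset.inf'_le _ hy'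
        have h2 : ‖x.1 - y'.1‖ ≤ ‖x.1 - y.1‖ + ‖y.1 - y'.1‖ := norm_sub_le_norm_sub_add_norm_sub _ _ _
        linarith
    have := (Finset.le_inf'_iff h _).2 key
    linarith
  · simp

/-- A function whose oscillation is at most `a` (`V g ≤ V g' + a` for all `g, g'`) has a window
`lo ≤ V ≤ lo + a` (`lo` = its infimum). -/
theorem exists_window_of_osc {α : Type*} (g₀ : α) {V : α → ℝ} {a : ℝ} (h : ∀ g g', V g ≤ V g' + a) :
    ∃ lo, ∀ g, lo ≤ V g ∧ V g ≤ lo + a := by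
  have hbdd : BddBelow (Set.range V) :=
    ⟨V g₀ - a, by rintro _ ⟨g, rfl⟩; linarith [h g₀ g]⟩
  refine ⟨sInf (Set.range V), fun g => ⟨csInf_le hbdd ⟨g, rfl⟩, ?_⟩⟩
  have : V g - a ≤ sInf (Set.range V) :=
    le_csInf ⟨V g₀, g₀, rfl⟩ (by rintro _ ⟨g', rfl⟩; linarith [h g g'])
  linarith

end Bookkeeping

/-! ### The one-link perturbation: window and cross-Lipschitz bound from the loads -/

section OneLinkLoads

variable {W : Potential (ZdEdge d) (Matrix.specialUnitaryGroup (Fin N) ℂ)}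
  {supp : Finset (ZdEdge d) → Finset (Finset (ZdEdge d))}

/-- **Oscillation of the one-link perturbation**: if `osc X e` bounds the oscillation of `W_X` IN
THE LINK `e` (`Dobrushin.IsOscBound (W X) (osc X)`), then `V_ω(g) = H^W_{e}(ω^{e←g})` satisfies
`V_ω(g) - V_ω(g') ≤ ∑_{X ∈ supp{e}, e ∈ X} osc X e` for all `g, g'`. -/
theorem hamiltonianIn_singleton_update_osc {osc : Finset (ZdEdge d) → ZdEdge d → ℝ}
    (hosc : ∀ X, Dobrushin.IsOscBound (W X) (osc X)) (e : ZdEdge d)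
    (ω : LGConfig d (Matrix.specialUnitaryGroup (Fin N) ℂ)) (g g' : Matrix.specialUnitaryGroup (Fin N) ℂ) :
    hamiltonianIn W supp {e} (Function.update ω e g) ≤
      hamiltonianIn W supp {e} (Function.update ω e g') + ∑ X ∈ (supp {e}).filter (fun X => e ∈ X), osc X e := by
  unfold hamiltonianIn
  rw [filter_inter_singleton_eq, ← Finset.sum_add_distrib]
  refine Finset.sum_le_sum fun X _ => ?_
  have h := (hosc X).le e (Function.update ω e g) (Function.update ω e g') fun z hz => by
    rw [Function.update_of_ne hz, Function.update_of_ne hz]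
  linarith [(abs_le.1 h).2]

/-- **Cross-Lipschitz bound of the one-link perturbation**: if `|W_X(U) - W_X(U')| ≤ lip X y ‖U_y - U'_y‖_F`
whenever `U = U'` off `y`, then for boundary conditions `ω = η` off `y ≠ e` and every `g`,
`|V_ω(g) - V_η(g)| ≤ (∑_{X ∈ supp{e}, e ∈ X} lip X y) ‖ω_y - η_y‖_F`. -/
theorem abs_hamiltonianIn_singleton_update_sub_le {lip : Finset (ZdEdge d) → ZdEdge d → ℝ}
    (hlip : ∀ X, IsLipBound suFrobDist (W X) (lip X))
    {e y : ZdEdge d} (hye : y ≠ e) {ω η : LGConfig d (Matrix.specialUnitaryGroup (Fin N) ℂ)}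
    (hωη : ∀ z, z ≠ y → ω z = η z) (g : Matrix.specialUnitaryGroup (Fin N) ℂ) :
    |hamiltonianIn W supp {e} (Function.update ω e g) - hamiltonianIn W supp {e} (Function.update η e g)| ≤
      (∑ X ∈ (supp {e}).filter (fun X => e ∈ X), lip X y) * suFrobDist (ω y) (η y) := by
  unfold hamiltonianIn
  rw [filter_inter_singleton_eq, ← Finset.sum_sub_distrib, Finset.sum_mul]
  refine (Finset.abs_sum_le_sum_abs _ _).trans (Finset.sum_le_sum fun X _ => ?_)
  have hupd : ∀ z, z ≠ y → Function.update ω e g z = Function.update η e g z := fun z hz => by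
    by_cases hze : z = e
    · subst hze; simp
    · rw [Function.update_of_ne hze, Function.update_of_ne hze]; exact hωη z hz
  have h := (hlip X).le y _ _ hupd
  rwa [Function.update_of_ne hye, Function.update_of_ne hye] at h

end OneLinkLoads

/-! ### The door: Dobrushin's condition for the member, uniformly in the loads -/

section Door

/-- **Dobrushin's condition (Vasserstein form) for the perturbed `SU(N)` specification, UNIFORM IN THE
LOADS.** Let `d ≥ 1`, `N ≥ 1`, `β` a 't Hooft coupling and `b ≥ 2(d-1)|β|`; let `(c, v)` be a one-link
Poincaré / variance pair for the Wilson one-link family `ν_B ∝ exp(N Re tr(g B)) σ_N` on `‖B‖_op ≤ b`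
(bodies of the cell's `OneLinkPoincareBound` / the tree's `OneLinkVarianceBound`, written out); let
`W` be an adapted link potential, supported by `supp`, with per-link oscillation witnesses `osc` of total
load `≤ a` through every link and per-link Lipschitz witnesses `lip`. Then `perturbedYM (fundamentalRep (Fin N)) (N β) W supp`
satisfies `IsKRContraction` for the Frobenius weight, the range `perturbedNbr supp`, and the influence
coefficients `C(e, y) = e^{a} √(c v) |β| n(e, y) + e^{a/2} √c ℓ(e, y)`,
`ℓ(e, y) = ∑_{X ∈ supp{e}, e ∈ X} lip X y` — the robust one-link lemma
`abs_integral_perturbedOneLink_sub_le` at the staple fields `B_η, B_ω` (`‖·‖_op ≤ 2(d-1)|β|`,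
`‖B_ω - B_η‖_F ≤ |β| n(e,y) ‖ω_y - η_y‖_F`) and the one-link perturbations `V_η, V_ω`. -/
theorem isKRContraction_perturbedYM_SU (hd : 1 ≤ d) (hN : 1 ≤ N) {β b c v a : ℝ} (hc : 0 ≤ c)
    (hv : 0 ≤ v) (hb : |β| * (2 * ((d : ℝ) - 1)) ≤ b)
    (hP : ∀ B : Matrix (Fin N) (Fin N) ℂ, matrixOpNorm B ≤ b →
      ∀ (ψ : Matrix.specialUnitaryGroup (Fin N) ℂ → ℝ) (M : ℝ), 0 ≤ M →
        (∀ x y, |ψ x - ψ y| ≤ M * suFrobDist x y) →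
        Var[ψ; (haarProbability (Matrix.specialUnitaryGroup (Fin N) ℂ)).tilted
          fun g => (N : ℝ) * ((g : Matrix (Fin N) (Fin N) ℂ) * B).trace.re] ≤ c * M ^ 2)
    (hVB : ∀ B : Matrix (Fin N) (Fin N) ℂ, matrixOpNorm B ≤ b → ∀ Δ : Matrix (Fin N) (Fin N) ℂ,
      Var[fun g : Matrix.specialUnitaryGroup (Fin N) ℂ =>
          (N : ℝ) * ((g : Matrix (Fin N) (Fin N) ℂ) * Δ).trace.re;
        (haarProbability (Matrix.specialUnitaryGroup (Fin N) ℂ)).tilted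
          fun g => (N : ℝ) * ((g : Matrix (Fin N) (Fin N) ℂ) * B).trace.re] ≤ v * frobNorm Δ ^ 2)
    {W : Potential (ZdEdge d) (Matrix.specialUnitaryGroup (Fin N) ℂ)} (hW : W.IsAdapted)
    {supp : Finset (ZdEdge d) → Finset (Finset (ZdEdge d))}
    {osc : Finset (ZdEdge d) → ZdEdge d → ℝ} (hosc : ∀ X, Dobrushin.IsOscBound (W X) (osc X))
    (hosca : ∀ e, ∑ X ∈ (supp {e}).filter (fun X => e ∈ X), osc X e ≤ a)
    {lip : Finset (ZdEdge d) → ZdEdge d → ℝ} (hlip : ∀ X, IsLipBound suFrobDist (W X) (lip X)) :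
    IsKRContraction (perturbedYM (d := d) (fundamentalRep (Fin N)) (N * β) W supp) suFrobDist
      (perturbedNbr supp) fun e y =>
        exp a * Real.sqrt (c * v) * |β| * linkInfluence e y +
          exp (a / 2) * Real.sqrt c * ∑ X ∈ (supp {e}).filter (fun X => e ∈ X), lip X y := by
  classical
  haveI : SecondCountableTopology (Matrix (Fin N) (Fin N) ℂ) :=
    inferInstanceAs (SecondCountableTopology (Fin N → Fin N → ℂ))
  haveI : SecondCountableTopology (Matrix.specialUnitaryGroup (Fin N) ℂ) :=
    Topology.IsEmbedding.subtypeVal.secondCountableTopology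
  have hWm : ∀ X, Measurable (W X) := fun X => (hW X).2
  refine isKRContraction_perturbedYM (fundamentalRep (Fin N)) (continuous_fundamentalRep (Fin N)) (N * β)
    hW supp (fun e y => add_nonneg (by positivity)
      (mul_nonneg (by positivity) (Finset.sum_nonneg fun X _ => (hlip X).nonneg y))) ?_
  intro e y hy ω η hωη φ L hφm hφb hL hφL
  have hye : y ≠ e := ne_of_mem_of_not_mem hy (not_mem_perturbedNbr supp e)
  rw [siteLaw_perturbedYM_thooft β hWm supp e ω, siteLaw_perturbedYM_thooft β hWm supp e η]
  -- the one-link data at `η` (base) and `ω`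
  set ℓ : ℝ := ∑ X ∈ (supp {e}).filter (fun X => e ∈ X), lip X y with hℓ
  have hℓ0 : 0 ≤ ℓ := Finset.sum_nonneg fun X _ => (hlip X).nonneg y
  have hr0 : 0 ≤ suFrobDist (ω y) (η y) := suFrobDist_nonneg _ _
  have hVm : ∀ ζ : LGConfig d (Matrix.specialUnitaryGroup (Fin N) ℂ),
      Measurable fun g : Matrix.specialUnitaryGroup (Fin N) ℂ =>
        hamiltonianIn W supp {e} (Function.update ζ e g) := fun ζ =>
    (measurable_hamiltonianIn hWm supp {e}).comp (measurable_update ζ)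
  have hoscV : ∀ (ζ : LGConfig d (Matrix.specialUnitaryGroup (Fin N) ℂ)) (g g' : Matrix.specialUnitaryGroup (Fin N) ℂ),
      hamiltonianIn W supp {e} (Function.update ζ e g) ≤ hamiltonianIn W supp {e} (Function.update ζ e g') + a :=
    fun ζ g g' => (hamiltonianIn_singleton_update_osc (supp := supp) hosc e ζ g g').trans
      (add_le_add_right (hosca e) _)
  obtain ⟨lo, hwinω⟩ := exists_window_of_osc (1 : Matrix.specialUnitaryGroup (Fin N) ℂ) (hoscV ω)
  obtain ⟨lo', hwinη⟩ := exists_window_of_osc (1 : Matrix.specialUnitaryGroup (Fin N) ℂ) (hoscV η)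
  have hcross : ∀ g, |hamiltonianIn W supp {e} (Function.update ω e g) -
      hamiltonianIn W supp {e} (Function.update η e g)| ≤ ℓ * suFrobDist (ω y) (η y) := fun g =>
    abs_hamiltonianIn_singleton_update_sub_le (supp := supp) hlip hye hωη g
  -- the staple fields lie in the ball and differ by `≤ |β| n(e,y) ‖ω_y - η_y‖_F`
  have hBω : matrixOpNorm (stapleField β e ω) ≤ b := (matrixOpNorm_stapleField_le hd hN β e ω).trans hb
  have hBη : matrixOpNorm (stapleField β e η) ≤ b := (matrixOpNorm_stapleField_le hd hN β e η).trans hb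
  have hΔB : frobNorm (stapleField β e ω - stapleField β e η) ≤
      |β| * linkInfluence e y * suFrobDist (ω y) (η y) := frobNorm_stapleField_sub_le β e y hωη
  -- the robust one-link lemma
  have key := abs_integral_perturbedOneLink_sub_le (N := N) hc hv (mul_nonneg hℓ0 hr0) hL hP hVB hBη hBω
    (hVm η) (hVm ω) hwinη hwinω hcross hφm hφb hφL
  refine key.trans ?_
  have h1 : exp a * Real.sqrt (c * v) * frobNorm (stapleField β e ω - stapleField β e η) ≤
      exp a * Real.sqrt (c * v) * (|β| * linkInfluence e y * suFrobDist (ω y) (η y)) :=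
    mul_le_mul_of_nonneg_left hΔB (by positivity)
  calc L * (exp a * Real.sqrt (c * v) * frobNorm (stapleField β e ω - stapleField β e η) +
        exp (a / 2) * Real.sqrt c * (ℓ * suFrobDist (ω y) (η y)))
      ≤ L * (exp a * Real.sqrt (c * v) * (|β| * linkInfluence e y * suFrobDist (ω y) (η y)) +
        exp (a / 2) * Real.sqrt c * (ℓ * suFrobDist (ω y) (η y))) := by
        gcongr
    _ = (exp a * Real.sqrt (c * v) * |β| * linkInfluence e y + exp (a / 2) * Real.sqrt c * ℓ) * L *
          suFrobDist (ω y) (η y) := by ring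

/-- **The row sums of the robust influence coefficients**:
`∑_{y ∈ perturbedNbr supp e} C(e, y) ≤ ρ := 6(d-1)|β| e^{a} √(c v) + e^{a/2} √c Λ`, from
`∑_y n(e, y) ≤ 6(d-1)` (`sum_linkInfluence_le_of_subset`) and the cross-Lipschitz load
`∑_{y ∈ perturbedNbr supp e} ℓ(e, y) ≤ Λ`. Both bounds are on NUMBERS `(β, a, Λ, c, v)`, not on the
particular `W` (referee test T2.4). -/
theorem sum_perturbedNbr_coeff_le (hd : 1 ≤ d) {β c v a Λ : ℝ}
    {supp : Finset (ZdEdge d) → Finset (Finset (ZdEdge d))} {lip : Finset (ZdEdge d) → ZdEdge d → ℝ}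
    (hΛ : ∀ e, ∑ y ∈ perturbedNbr supp e, ∑ X ∈ (supp {e}).filter (fun X => e ∈ X), lip X y ≤ Λ)
    (e : ZdEdge d) :
    ∑ y ∈ perturbedNbr supp e,
        (exp a * Real.sqrt (c * v) * |β| * linkInfluence e y +
          exp (a / 2) * Real.sqrt c * ∑ X ∈ (supp {e}).filter (fun X => e ∈ X), lip X y) ≤
      6 * ((d : ℝ) - 1) * |β| * (exp a * Real.sqrt (c * v)) + exp (a / 2) * Real.sqrt c * Λ := by
  classical
  rw [Finset.sum_add_distrib, ← Finset.mul_sum, ← Finset.mul_sum]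
  have hn : ∑ y ∈ perturbedNbr supp e, (linkInfluence e y : ℝ) ≤ 6 * ((d : ℝ) - 1) := by
    have h := sum_linkInfluence_le_of_subset e (perturbedNbr supp e)
    calc ∑ y ∈ perturbedNbr supp e, (linkInfluence e y : ℝ)
        = ((∑ y ∈ perturbedNbr supp e, linkInfluence e y : ℕ) : ℝ) := by push_cast; rfl
      _ ≤ ((6 * (d - 1) : ℕ) : ℝ) := by exact_mod_cast h
      _ = 6 * ((d : ℝ) - 1) := by push_cast [Nat.cast_sub hd]; ring
  have h1 : exp a * Real.sqrt (c * v) * |β| * ∑ y ∈ perturbedNbr supp e, (linkInfluence e y : ℝ) ≤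
      exp a * Real.sqrt (c * v) * |β| * (6 * ((d : ℝ) - 1)) :=
    mul_le_mul_of_nonneg_left hn (by positivity)
  have h2 : exp (a / 2) * Real.sqrt c *
      ∑ y ∈ perturbedNbr supp e, ∑ X ∈ (supp {e}).filter (fun X => e ∈ X), lip X y ≤
      exp (a / 2) * Real.sqrt c * Λ :=
    mul_le_mul_of_nonneg_left (hΛ e) (by positivity)
  calc _ ≤ exp a * Real.sqrt (c * v) * |β| * (6 * ((d : ℝ) - 1)) + exp (a / 2) * Real.sqrt c * Λ :=
        add_le_add h1 h2
    _ = _ := by ring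

end Door

end Summit.Ventures.YMGap.RobustBall
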